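import Summits.ABC.IUTFork.Joshi.Multiplicatoids
import HarnessLib

/-!
# Joshi, ATS III §11 multiplicatoids — NON-VACUITY MODELS and two computations of the perfection (support file, no node)

Proof-only companion of `Joshi/Multiplicatoids.lean` (p431265; abc-iut cell, block E, rung LADDER-ABC:A2.E, seat abc-iut-E-t11 —
AUTHORS-FIRST NV witness of its own interface structures, E-plan-2 RULINGS 08:22:53Z (5)). Source: K. Joshi, arXiv:2401.13508 **v4**
(unrefereed; bib `Joshi2024ATS3`) §11, PDF pp. 142–145 of `HOME/lit/renders/Joshi-arxiv-2401.13508/`. TAKES NO SIDE on [IUTchIII]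
Cor. 3.12, on Joshi's claims or on Mochizuki's report; a model exhibits satisfiability of a typed signature / claim-Prop, nothing
more; typed ≠ proved ≠ endorsed. No new definition of Joshi's; nothing of OUR interface imported.

CONTENTS (all PROVED):
* §A two COMPUTATIONS of the §11.1 perfection `A^{pf} = lim←_n (A, x ↦ xⁿ)` (Prop. 11.1.1, p.142 l.13–26): for the additive group `ℤ`
  the perfection is TRIVIAL (`addPerfection_int_eq_bot`: a compatible family has `a_1 = n·a_n` for every `n`, so `a_1 = 0`, and then
  every `a_m = 0`) — the perfection KILLS non-divisible groups —, while for `ℚ` it is NON-TRIVIAL (`ratFamily`: `n ↦ q/n` is a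
  compatible family; `addPerfection_rat_ne_bot`). So «the stalks are ℚ-vector spaces» (p.142 l.24–26) is bought by discarding all
  non-divisible information: a kernel fact about the typed construction, recorded for the referee lanes (no verdict).
* §B INHABITED INSTANCES: the constant units presheaf on the opens of any space (`constPresheaf`), its perfect multiplicatoid, the
  identity isomorphism of pairs for a constant presheaf (`PairIso.reflConst`) whence `solvesBasicProblem_const` (a pair solves its own problem (11.3.1)
  — the trivial solution; print's question is about OTHER solutions), `Prop1111` holds with `sheafClause := True` and fails with
  `False` (`prop1111_true`, `not_prop1111_false`: as typed, the Proposition's content is exactly its sheaf clause).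
* §C the claim-Props at small index families: `Thm1141` holds on a one-member family (`thm1141_unit`); `Thm1171` (1)(3) hold and (2)
  FAILS on a one-untilt class (`not_thm1171_2_unit` — via `thm1171_2_nontrivial`), while on a two-untilt class with `IsoSp := (· = ·)`
  the full `Thm1171` HOLDS (`thm1171_bool`): the typed content of Thm. 11.7.1 (2) is precisely «the class has two members the
  isomorphism relation separates» ([Kedlaya–Temkin 2018] in print).
-/

noncomputable section

open Set TopologicalSpace

namespace Summit.ABC.IUTFork.Joshi.ATS3.Multiplicatoids

/-! ## §A The perfection of `ℤ` is trivial; the perfection of `ℚ` is not -/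

/-- In the additive perfection of `ℤ` every compatible family vanishes: `a_1 = n • a_n` for all `n ≥ 1` forces `a_1 = 0` (an integer
divisible by every `n`), and `a_m = n • a_{m·n}` likewise forces each `a_m = 0`. [folklore] -/
theorem addPerfection_int_eq_bot : AddPerfection ℤ = ⊥ := by
  refine (Subgroup.eq_bot_iff_forall _).2 fun a ha => ?_
  funext m
  -- the `m`-th coordinate is divisible by every positive integer `k` (compatibility with `n = m·k`)
  have hdiv : ∀ k : ℕ+, ((k : ℕ) : ℤ) ∣ Multiplicative.toAdd (a m) := fun k => by
    refine ⟨Multiplicative.toAdd (a (m * k)), ?_⟩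
    have h := congrArg Multiplicative.toAdd (ha m (m * k) k (PNat.mul_coe m k))
    rw [toAdd_pow] at h
    rw [← h, nsmul_eq_mul]
  -- an integer divisible by `|x| + 1` is `0`
  have hx : Multiplicative.toAdd (a m) = 0 := by
    obtain ⟨c, hc⟩ := hdiv ⟨(Multiplicative.toAdd (a m)).natAbs + 1, Nat.succ_pos _⟩
    refine Int.eq_zero_of_dvd_of_natAbs_lt_natAbs ⟨c, hc⟩ ?_
    rw [PNat.mk_coe, Int.natAbs_natCast]
    exact Nat.lt_succ_self _
  show a m = 1
  exact Multiplicative.toAdd.injective (by rw [hx, toAdd_one])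

/-- The compatible family `n ↦ q/n` in the additive perfection of `ℚ` (the perfection of a DIVISIBLE torsion-free group is the group
itself; here one family per rational `q`). [folklore] -/
def ratFamily (q : ℚ) : AddPerfection ℚ :=
  ⟨fun n => Multiplicative.ofAdd (q / n), fun m n k h => by
    show Multiplicative.ofAdd (q / n) ^ k = Multiplicative.ofAdd (q / m)
    rw [← ofAdd_nsmul, nsmul_eq_mul]
    congr 1
    have hm : ((m : ℕ) : ℚ) ≠ 0 := by exact_mod_cast m.ne_zero
    have hk : ((k : ℕ) : ℚ) ≠ 0 := by
      have : k ≠ 0 := by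
        rintro rfl
        rw [mul_zero] at h
        exact n.ne_zero h
      exact_mod_cast this
    have hn : ((n : ℕ) : ℚ) = (m : ℕ) * k := by exact_mod_cast h
    rw [hn]
    field_simp⟩

/-- Its first coordinate is `q`. [folklore] -/
theorem ratFamily_one (q : ℚ) : ((ratFamily q : AddPerfection ℚ) : ℕ+ → Multiplicative ℚ) 1 = Multiplicative.ofAdd q := by
  show Multiplicative.ofAdd (q / ((1 : ℕ+) : ℕ)) = _
  simp

/-- The additive perfection of `ℚ` is NON-TRIVIAL. [folklore] -/
theorem addPerfection_rat_ne_bot : AddPerfection ℚ ≠ ⊥ := by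
  intro h
  have hmem : (fun n : ℕ+ => Multiplicative.ofAdd ((1 : ℚ) / n)) ∈ AddPerfection ℚ := (ratFamily 1).2
  rw [h, Subgroup.mem_bot] at hmem
  have h2 := congr_fun hmem 1
  simp only [PNat.one_coe, Nat.cast_one, div_one, Pi.one_apply] at h2
  exact one_ne_zero (Multiplicative.ofAdd.injective (h2.trans ofAdd_zero.symm))

/-! ## §B Inhabited instances: the constant presheaf, the identity isomorphism of pairs, Prop. 11.1.1's two clauses -/

/-- The CONSTANT units presheaf with value `A` on any preorder of opens (all restrictions the identity) — an inhabitant of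
`UnitsPresheaf`. [folklore] -/
def constPresheaf (Open : Type*) [Preorder Open] (A : Type*) [CommGroup A] : UnitsPresheaf Open fun _ : Open => A where
  res _ := MonoidHom.id A
  res_self _ := rfl
  res_comp _ _ := rfl

/-- The identity isomorphism of pairs for a CONSTANT units presheaf and its perfect multiplicatoid: homeomorphism `refl`,
identity on sections (sections do not depend on the open, so no transport is needed). [folklore] -/
def PairIso.reflConst (X : Type*) [TopologicalSpace X] (A : Type*) [CommGroup A] :
    PairIso (perfectMultiplicatoidOf (constPresheaf (Opens X) A)) (perfectMultiplicatoidOf (constPresheaf (Opens X) A)) where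
  homeo := Homeomorph.refl X
  iso _ := MulEquiv.refl _
  iso_res _ _ := rfl

/-- **A pair solves its own basic problem (11.3.1)** — the trivial solution `Y := X`, here for every constant units presheaf
(print's problem, p.143 l.30–47, asks for the OTHER solutions). NON-VACUITY of `SolvesBasicProblem`. [folklore] -/
theorem solvesBasicProblem_const (X : Type*) [TopologicalSpace X] (A : Type*) [CommGroup A] :
    SolvesBasicProblem (constPresheaf (Opens X) A) (constPresheaf (Opens X) A) :=
  ⟨PairIso.reflConst X A⟩

/-- Prop. 11.1.1 AS TYPED holds as soon as its sheaf clause does (here `True`): the sections clause is a theorem. [folklore] -/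
theorem prop1111_true {X : Type*} [TopologicalSpace X] {F : Opens X → Type*} [∀ U, CommGroup (F U)]
    (P : UnitsPresheaf (Opens X) F) : Prop1111 P True :=
  (prop1111_iff_sheafClause P True).2 trivial

/-- … and fails when the clause fails: the content of the typed Proposition IS its sheaf clause. [folklore] -/
theorem not_prop1111_false {X : Type*} [TopologicalSpace X] {F : Opens X → Type*} [∀ U, CommGroup (F U)]
    (P : UnitsPresheaf (Opens X) F) : ¬ Prop1111 P False := fun h =>
  (prop1111_iff_sheafClause P False).1 h

/-- A concrete inhabitant: the units `ℚˣ` as a constant presheaf on the one-point space — its perfect multiplicatoid solves its own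
basic problem. [folklore] -/
example : SolvesBasicProblem (constPresheaf (Opens Unit) ℚˣ) (constPresheaf (Opens Unit) ℚˣ) :=
  solvesBasicProblem_const Unit ℚˣ

/-! ## §C The claim-Props at small index families -/

/-- Thm. 11.4.1 AS TYPED holds on a one-member family (only the diagonal is asked). Satisfiable; content = off-diagonal. [folklore] -/
theorem thm1141_unit (G : Unit → Type*) [∀ i, Group (G i)] [∀ i, TopologicalSpace (G i)] (Kbar : Unit → Type*)
    [∀ i, Field (Kbar i)] : Thm1141 G Kbar := fun i j _ => by
  cases i; cases j; exact thm1141_refl G Kbar ()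

section OneUntilt

/-- On a ONE-untilt class with a reflexive isomorphism relation, Thm. 11.7.1 (2) AS TYPED is FALSE (no two members to separate).
[folklore] -/
theorem not_thm1171_2_unit (sp : Unit → Type*) [∀ u, TopologicalSpace (sp u)] (M : ∀ u, Opens (sp u) → Type*)
    [∀ u V, CommMonoid (M u V)] : ¬ Thm1171_2 Unit sp M (fun _ _ => True) := fun h => by
  obtain ⟨u, v, hne⟩ := thm1171_2_nontrivial Unit sp M (fun _ _ => True) (fun _ => trivial) h
  exact hne (Subsingleton.elim u v)

end OneUntilt

section TwoUntilts

/-- On the TWO-untilt class `Bool` (both untilts with underlying space a point, trivial monoid presheaves and trivial `π₁`), with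
«isomorphic as perfectoid spaces» := equality, the full Thm. 11.7.1 AS TYPED HOLDS: (1) identity homeomorphisms and isomorphisms,
(2) `false ≠ true`, (3) trivial groups. So the typed (2) is satisfiable and its content is exactly the separation of two members.
[folklore] -/
theorem thm1171_bool :
    Thm1171 Bool (fun _ => Unit) (fun _ _ => Unit) (fun _ => Unit) (fun u v => u = v) := by
  refine ⟨fun u v => ⟨Homeomorph.refl Unit, fun V => ⟨MulEquiv.refl Unit⟩⟩, ?_, fun u v => ⟨MulEquiv.refl Unit⟩⟩
  exact ⟨false, true, Bool.false_ne_true, Homeomorph.refl Unit, fun V => ⟨MulEquiv.refl Unit⟩⟩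

end TwoUntilts

end Summit.ABC.IUTFork.Joshi.ATS3.Multiplicatoids

end
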